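import Summits.Ventures.Crystal3D.Bulk.CapX2Sound
import Summits.Ventures.Crystal3D.Bulk.SphereCodeCut
import HarnessLib

/-!
# Soundness of the pole-augmented («X2») cap certificates, II: the format `X2Cert` and the cut

HONEST FRAMING. Part of the venture `Summits/Ventures/Crystal3D` (cell `pub-crystal3d`, phase 2,
decision sprint; seat p1). Continuation of `Bulk/CapX2Sound.lean` (the accounting). Here: the integer
reading of the accounting — with (N) `12·M + 440·ε₃ < 132·λ` a twelve-point sub-code is impossible, so
an `s`-code in the cap has at most ELEVEN points (`card_le_eleven_of_accounting`, `card_le_eleven_factored`,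
both positivity inputs being theorems of the tree) — and the certificate FORMAT `X2Cert` the cell's SDP
lane hands over after rounding (all data rational, positive semidefiniteness BY CONSTRUCTION as in p3's
`CapCert`): the cap part IS a `CapCert` (`u₀`, basis `W`, factor `L`; pole `e`), the X2 part is a row
basis `WX k i` (coefficient lists, e.g. the Chebyshev `T_i` written out) and the two halves `M1 k i r`,
`M2 k i r` of a factor of `G_k = [[G11,G12],[G12ᵀ,G22]] ⪰ 0`; real semantics
`X2Cert.a/b/S11/S12/S22/diagTot/pairPoly/tripleSym` (FORMAT-t2x2's `Dtot`, `P`, `S₃`), the NAMED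
inequalities `IneqI/IneqII/IneqIII` a certificate must come with (hypotheses — certified outside Lean by
the cell's exact checkers unless replayed), the decidable rational test `IneqN`, and the conclusions
`X2Cert.card_le_eleven`, `capCodeBound_of_x2Cert : … → CapCodeBound u₀`,
`noHole_of_x2Cert : … → NoHole (-u₀)` (typer-bulk's `noHole_of_capCodeBound`, `Bulk/SphereCodeCut.lean`).
For the window of record: a certificate with `u₀ = -61/100` gives `NoHole 0.61`, `ρ* < 52.4105°`.

NO certificate data and NO polynomial inequality is asserted here; nothing is claimed about any level.

References: C. Bachoc, F. Vallentin, J. Amer. Math. Soc. 21 (2008), Cor. 3.5 [`BachocVallentin2007`];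
European J. Combin. 30 (2009), Thm 2.2/4.4 [`BachocVallentin2009`].
-/

noncomputable section

open Finset
open scoped InnerProductSpace
open Literature.Geometry.DiscreteGeometry Literature.Geometry.DiscreteGeometry.BachocVallentin

namespace Summit.Ventures.Crystal3D.CapX2

/-! ## The integer reading -/

/-- **Twelve points are impossible, so at most eleven** (the integer reading of an X2 certificate):
under positivity hypotheses valid for EVERY finite sub-configuration (as the factored kernels give),
(I)(II)(III) and (N) `12·M + 440·ε₃ < 132·λ` imply `|C| ≤ 11` — apply `accounting` to a 12-point
sub-code (`12·11 = 132`, `12·11·10/3 = 440`). -/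
theorem card_le_eleven_of_accounting (s u₀ : ℝ) (e : EuclideanSpace ℝ (Fin 3)) (he : ‖e‖ = 1)
    (C : Finset (EuclideanSpace ℝ (Fin 3))) (hC : ∀ x ∈ C, ‖x‖ = 1)
    (hcode : ∀ x ∈ C, ∀ y ∈ C, x ≠ y → ⟪x, y⟫_ℝ ≤ s) (hcap : ∀ x ∈ C, u₀ ≤ ⟪e, x⟫_ℝ)
    (Kp S11 S12 S22 : ℝ → ℝ → ℝ → ℝ) (M lam eps3 : ℝ)
    (hK : ∀ C' ⊆ C, 0 ≤ ∑ x ∈ C', ∑ y ∈ C', Kp ⟪e, x⟫_ℝ ⟪e, y⟫_ℝ ⟪x, y⟫_ℝ)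
    (hblock : ∀ C' ⊆ C, ∀ x ∈ C', 0 ≤ (∑ y ∈ C', ∑ z ∈ C', S11 ⟪x, y⟫_ℝ ⟪x, z⟫_ℝ ⟪y, z⟫_ℝ)
      + 2 * (∑ y ∈ C', S12 ⟪x, y⟫_ℝ (-⟪e, x⟫_ℝ) (-⟪e, y⟫_ℝ)) + S22 (-⟪e, x⟫_ℝ) (-⟪e, x⟫_ℝ) 1)
    (hS : ∀ u v t : ℝ, S11 u v t = S11 v u t)
    (h1 : ∀ u : ℝ, u₀ ≤ u → u ≤ 1 →
      Kp u u 1 + S11 1 1 1 + 2 * S12 1 (-u) (-u) + S22 (-u) (-u) 1 ≤ M)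
    (h2 : ∀ u v t : ℝ, u₀ ≤ u → u ≤ 1 → u₀ ≤ v → v ≤ 1 → -1 ≤ t → t ≤ s →
      0 ≤ 1 + 2 * u * v * t - u ^ 2 - v ^ 2 - t ^ 2 →
      Kp u v t + S11 1 t t + S11 t 1 t + S11 t t 1 + S12 t (-u) (-v) + S12 t (-v) (-u) ≤ -lam)
    (h3 : ∀ a b c : ℝ, -1 ≤ a → a ≤ s → -1 ≤ b → b ≤ s → -1 ≤ c → c ≤ s →
      0 ≤ 1 + 2 * a * b * c - a ^ 2 - b ^ 2 - c ^ 2 → S11 a b c + S11 a c b + S11 b c a ≤ eps3)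
    (hN : 12 * M + 440 * eps3 < 132 * lam) : C.card ≤ 11 := by
  by_contra hlt
  push Not at hlt
  obtain ⟨C', hsub, hcard⟩ := Finset.exists_subset_card_eq (show 12 ≤ C.card by omega)
  have h := accounting s u₀ e he C' (fun x hx => hC x (hsub hx))
    (fun x hx y hy => hcode x (hsub hx) y (hsub hy)) (fun x hx => hcap x (hsub hx))
    Kp S11 S12 S22 M lam eps3 (hK C' hsub) (hblock C' hsub) hS h1 h2 h3
  rw [hcard] at h
  norm_num at h
  linarith

/-- **Soundness of factored X2 certificates (real form).** Cap family `K = capKernel3 K R g` (pole `e`)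
and pole kernels `S11 = poleKernel3 KX RX a a`, `S12 = poleKernel3 KX RX a b`,
`S22 = poleKernel3 KX RX b b` (any real functions `g, a, b`): (I)(II)(III)(N) ⇒ every finite `s`-code in
the cap `⟪e,·⟫ ≥ u₀` has at most eleven points. Both positivity inputs are theorems of the tree. -/
theorem card_le_eleven_factored (s u₀ : ℝ) (e : EuclideanSpace ℝ (Fin 3)) (he : ‖e‖ = 1)
    (C : Finset (EuclideanSpace ℝ (Fin 3))) (hC : ∀ x ∈ C, ‖x‖ = 1)
    (hcode : ∀ x ∈ C, ∀ y ∈ C, x ≠ y → ⟪x, y⟫_ℝ ≤ s) (hcap : ∀ x ∈ C, u₀ ≤ ⟪e, x⟫_ℝ)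
    (K R : ℕ) (g : ℕ → ℕ → ℝ → ℝ) (KX RX : ℕ) (a b : ℕ → ℕ → ℝ → ℝ) (M lam eps3 : ℝ)
    (h1 : ∀ u : ℝ, u₀ ≤ u → u ≤ 1 →
      capKernel3 K R g u u 1 + poleKernel3 KX RX a a 1 1 1 + 2 * poleKernel3 KX RX a b 1 (-u) (-u)
        + poleKernel3 KX RX b b (-u) (-u) 1 ≤ M)
    (h2 : ∀ u v t : ℝ, u₀ ≤ u → u ≤ 1 → u₀ ≤ v → v ≤ 1 → -1 ≤ t → t ≤ s →
      0 ≤ 1 + 2 * u * v * t - u ^ 2 - v ^ 2 - t ^ 2 →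
      capKernel3 K R g u v t + poleKernel3 KX RX a a 1 t t + poleKernel3 KX RX a a t 1 t
        + poleKernel3 KX RX a a t t 1 + poleKernel3 KX RX a b t (-u) (-v)
        + poleKernel3 KX RX a b t (-v) (-u) ≤ -lam)
    (h3 : ∀ a' b' c' : ℝ, -1 ≤ a' → a' ≤ s → -1 ≤ b' → b' ≤ s → -1 ≤ c' → c' ≤ s →
      0 ≤ 1 + 2 * a' * b' * c' - a' ^ 2 - b' ^ 2 - c' ^ 2 →
      poleKernel3 KX RX a a a' b' c' + poleKernel3 KX RX a a a' c' b' + poleKernel3 KX RX a a b' c' a'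
        ≤ eps3)
    (hN : 12 * M + 440 * eps3 < 132 * lam) : C.card ≤ 11 :=
  card_le_eleven_of_accounting s u₀ e he C hC hcode hcap (capKernel3 K R g) (poleKernel3 KX RX a a)
    (poleKernel3 KX RX a b) (poleKernel3 KX RX b b) M lam eps3
    (fun C' hC' => sum_sum_capKernel3_nonneg K R g e he C' fun x hx => hC x (hC' hx))
    (fun C' hC' x hx => poleBlock_nonneg_antipode KX RX a b e x he (hC x (hC' hx)) C'
      fun y hy => hC y (hC' hy))
    (fun u v t => by rw [poleKernel3_swap]) h1 h2 h3 hN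

/-! ## The certificate format -/

/-- An X2 CERTIFICATE in factored form (all data rational; what the cell's SDP lane hands over after
rounding): the cap part `cap : CapCert` (cap level `u₀`, row basis `W`, factor `L` of the blocks
`F_k = L_k L_kᵀ ⪰ 0`, pole `e`), and the pole-augmented part: a column bound `RX`, for each block `k`
(list position) a polynomial ROW BASIS `WX k = [g_{k,0}, g_{k,1}, …]` (coefficient lists, lowest degree
first) and the two HALVES `M1 k`, `M2 k` (rows `i`, columns `r`) of a factor of the `2m × 2m` block
`G_k = [M1; M2] [M1; M2]ᵀ = [[G11,G12],[G12ᵀ,G22]] ⪰ 0`. Positive semidefiniteness is BY CONSTRUCTION;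
nothing else is claimed by the data. (FORMAT-t2x2: `L_cap`, `L_x2`; capcheck3: `L_exact`, `X_exact`.) -/
structure X2Cert where
  /-- the cap part (level `u₀`, basis, factor) -/
  cap : CapCert
  /-- a bound on the number of columns of every factor half `M1 k`, `M2 k` -/
  RX : ℕ
  /-- X2 row bases: `WX[k][i]` = coefficient list of `g_{k,i}` -/
  WX : List (List (List ℚ))
  /-- first halves of the factors: `M1[k][i][r]` -/
  M1 : List (List (List ℚ))
  /-- second halves of the factors: `M2[k][i][r]` -/
  M2 : List (List (List ℚ))

namespace X2Cert

/-- The cap level `u₀`. -/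
def u0 (c : X2Cert) : ℚ := c.cap.u0

/-- Number of X2 blocks `k` read (`= length of M1`). -/
def KX (c : X2Cert) : ℕ := c.M1.length

/-- Number of basis rows of X2 block `k`. -/
def rowsX (c : X2Cert) (k : ℕ) : ℕ := (c.WX.getD k []).length

/-- Basis polynomial `g_{k,i}` (zero outside the stored range). -/
def basisX (c : X2Cert) (k i : ℕ) : List ℚ := (c.WX.getD k []).getD i []

/-- Entry `M1_k[i][r]` (zero outside the stored range). -/
def entry1 (c : X2Cert) (k i r : ℕ) : ℚ := ((c.M1.getD k []).getD i []).getD r 0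

/-- Entry `M2_k[i][r]` (zero outside the stored range). -/
def entry2 (c : X2Cert) (k i r : ℕ) : ℚ := ((c.M2.getD k []).getD i []).getD r 0

/-- First-half column functions `a_{k,r}(A) = Σ_i M1_k[i][r] · g_{k,i}(A)`. -/
def a (c : X2Cert) (k r : ℕ) (A : ℝ) : ℝ :=
  ∑ i ∈ range (c.rowsX k), (c.entry1 k i r : ℝ) * upolyEval (c.basisX k i) A

/-- Second-half column functions `b_{k,r}(A) = Σ_i M2_k[i][r] · g_{k,i}(A)`. -/
def b (c : X2Cert) (k r : ℕ) (A : ℝ) : ℝ :=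
  ∑ i ∈ range (c.rowsX k), (c.entry2 k i r : ℝ) * upolyEval (c.basisX k i) A

/-- The cap kernel `K_p(u,v,t)` of the certificate (pole `e`). -/
def kernel (c : X2Cert) (u v t : ℝ) : ℝ := c.cap.kernel u v t

/-- `S11(A,B,C) = Σ_k ⟨G11_k, g(A) g(B)ᵀ⟩ Q_k(A,B,C)`. -/
def S11 (c : X2Cert) : ℝ → ℝ → ℝ → ℝ := poleKernel3 c.KX c.RX c.a c.a

/-- `S12(A,B,C) = Σ_k ⟨G12_k, g(A) g(B)ᵀ⟩ Q_k(A,B,C)`. -/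
def S12 (c : X2Cert) : ℝ → ℝ → ℝ → ℝ := poleKernel3 c.KX c.RX c.a c.b

/-- `S22(A,B,C) = Σ_k ⟨G22_k, g(A) g(B)ᵀ⟩ Q_k(A,B,C)`. -/
def S22 (c : X2Cert) : ℝ → ℝ → ℝ → ℝ := poleKernel3 c.KX c.RX c.b c.b

/-- The singles polynomial `D(u) = K_p(u,u,1) + S11(1,1,1) + 2 S12(1,-u,-u) + S22(-u,-u,1)`
(FORMAT-t2x2 (I): `Dtot`). -/
def diagTot (c : X2Cert) (u : ℝ) : ℝ :=
  c.kernel u u 1 + c.S11 1 1 1 + 2 * c.S12 1 (-u) (-u) + c.S22 (-u) (-u) 1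

/-- The ordered-pair polynomial
`P(u,v,t) = K_p(u,v,t) + S11(1,t,t) + S11(t,1,t) + S11(t,t,1) + S12(t,-u,-v) + S12(t,-v,-u)`
(FORMAT-t2x2 (II): `P`). -/
def pairPoly (c : X2Cert) (u v t : ℝ) : ℝ :=
  c.kernel u v t + c.S11 1 t t + c.S11 t 1 t + c.S11 t t 1 + c.S12 t (-u) (-v) + c.S12 t (-v) (-u)

/-- The symmetrised triple polynomial `S₃(a,b,c) = S11(a,b,c) + S11(a,c,b) + S11(b,c,a)`
(FORMAT-t2x2 (III): `S₃`). -/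
def tripleSym (c : X2Cert) (a' b' c' : ℝ) : ℝ := c.S11 a' b' c' + c.S11 a' c' b' + c.S11 b' c' a'

/-- Inequality (I): `D(u) ≤ M` on `[u₀, 1]`. NAMED HYPOTHESIS a certificate must come with. -/
def IneqI (c : X2Cert) (M : ℚ) : Prop :=
  ∀ u : ℝ, (c.u0 : ℝ) ≤ u → u ≤ 1 → c.diagTot u ≤ M

/-- Inequality (II): `P(u,v,t) ≤ -λ` on `Δ(u₀,s) = [u₀,1]² × [-1,s] ∩ {1 + 2uvt - u² - v² - t² ≥ 0}`.
NAMED HYPOTHESIS. -/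
def IneqII (c : X2Cert) (s lam : ℚ) : Prop :=
  ∀ u v t : ℝ, (c.u0 : ℝ) ≤ u → u ≤ 1 → (c.u0 : ℝ) ≤ v → v ≤ 1 → -1 ≤ t → t ≤ s →
    0 ≤ 1 + 2 * u * v * t - u ^ 2 - v ^ 2 - t ^ 2 → c.pairPoly u v t ≤ -lam

/-- Inequality (III): `S₃(a,b,c) ≤ ε₃` on `R₃(s) = [-1,s]³ ∩ {1 + 2abc - a² - b² - c² ≥ 0}`.
NAMED HYPOTHESIS. -/
def IneqIII (c : X2Cert) (s eps3 : ℚ) : Prop :=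
  ∀ a' b' c' : ℝ, -1 ≤ a' → a' ≤ s → -1 ≤ b' → b' ≤ s → -1 ≤ c' → c' ≤ s →
    0 ≤ 1 + 2 * a' * b' * c' - a' ^ 2 - b' ^ 2 - c' ^ 2 → c.tripleSym a' b' c' ≤ eps3

/-- Condition (N): `12·M + 440·ε₃ < 132·λ` (rational, decidable). -/
def IneqN (M lam eps3 : ℚ) : Prop := 12 * M + 440 * eps3 < 132 * lam

/-- (N) is a decidable rational comparison (`decide` / `norm_num` discharge it on explicit data). -/
instance (M lam eps3 : ℚ) : Decidable (IneqN M lam eps3) := by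
  unfold IneqN; infer_instance

/-- **What a checked X2 certificate proves**: if `c` satisfies (I) with `M`, (II) with `s, λ`, (III)
with `s, ε₃` and (N), then every finite set of unit vectors of `ℝ³` with pairwise inner products `≤ s`
inside a cap `{x : u₀ ≤ ⟪e, x⟫}` (`e` a unit vector) has at most eleven elements. -/
theorem card_le_eleven (c : X2Cert) (s M lam eps3 : ℚ) (hN : IneqN M lam eps3)
    (h1 : c.IneqI M) (h2 : c.IneqII s lam) (h3 : c.IneqIII s eps3)
    (e : EuclideanSpace ℝ (Fin 3)) (he : ‖e‖ = 1)
    (C : Finset (EuclideanSpace ℝ (Fin 3))) (hC : ∀ x ∈ C, ‖x‖ = 1)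
    (hcode : ∀ x ∈ C, ∀ y ∈ C, x ≠ y → ⟪x, y⟫_ℝ ≤ s) (hcap : ∀ x ∈ C, (c.u0 : ℝ) ≤ ⟪e, x⟫_ℝ) :
    C.card ≤ 11 := by
  have hN' : (12 : ℝ) * M + 440 * eps3 < 132 * lam := by
    have h : ((12 * M + 440 * eps3 : ℚ) : ℝ) < ((132 * lam : ℚ) : ℝ) := by exact_mod_cast hN
    push_cast at h
    exact h
  exact card_le_eleven_factored s c.u0 e he C hC hcode hcap c.cap.L.length c.cap.R c.cap.g
    c.KX c.RX c.a c.b M lam eps3 h1 h2 h3 hN'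

end X2Cert

/-! ## The cut -/

/-- **An X2 certificate at code angle `60°` IS a cap-code bound**: (I)(II)(III) with `s = 1/2` and (N)
give `CapCodeBound u₀` (no twelve-point `60°`-code in the closed cap `⟪e, x⟫ ≥ u₀`). -/
theorem capCodeBound_of_x2Cert (c : X2Cert) (M lam eps3 : ℚ) (hN : X2Cert.IneqN M lam eps3)
    (h1 : c.IneqI M) (h2 : c.IneqII (1 / 2) lam) (h3 : c.IneqIII (1 / 2) eps3) :
    CapCodeBound (c.u0 : ℝ) := by
  intro e he T hT hsep hcap
  have hsep' : ∀ v ∈ T, ∀ w ∈ T, v ≠ w → ⟪v, w⟫_ℝ ≤ ((1 / 2 : ℚ) : ℝ) := by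
    intro v hv w hw hvw
    rw [show ((1 / 2 : ℚ) : ℝ) = 1 / 2 by norm_num]
    exact hsep v hv w hw hvw
  exact X2Cert.card_le_eleven c (1 / 2) M lam eps3 hN h1 h2 h3 e he T hT hsep' hcap

/-- **An X2 certificate IS a cut, with no exchange rate**: (I)(II)(III)(N) at `s = 1/2` give
`NoHole (-u₀)` (`ρ* < arccos (-u₀)`), via typer-bulk's `noHole_of_capCodeBound`. For the window of
record: a certificate with `u₀ = -61/100` gives `NoHole 0.61`, `ρ* < 52.4105°`. -/
theorem noHole_of_x2Cert (c : X2Cert) (M lam eps3 : ℚ) (hN : X2Cert.IneqN M lam eps3)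
    (h1 : c.IneqI M) (h2 : c.IneqII (1 / 2) lam) (h3 : c.IneqIII (1 / 2) eps3) :
    NoHole (-(c.u0 : ℝ)) := by
  apply noHole_of_capCodeBound
  rw [neg_neg]
  exact capCodeBound_of_x2Cert c M lam eps3 hN h1 h2 h3

end Summit.Ventures.Crystal3D.CapX2

end
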